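import Literature.AlgebraicGeometry.Resolution.GermsOfClosedSubsets
import Literature.AlgebraicGeometry.Resolution.PrimeDivisorIdeals
import HarnessLib

/-!
# Supports of ideal sheaves near a point, via the generisations of the point

Topic: `Literature/AlgebraicGeometry/Resolution`. Complements to `GermsOfClosedSubsets.lean`
(the germ of a closed subset at `v` is read off the primes of `𝒪_{X,v}`, Stacks 01J7) and
`StalkSpecializesLocalization.lean` (`𝒪_{X,ζ} = (𝒪_{X,x})_{𝔭_ζ}` for `ζ ⤳ x`), in the form used
when walking from a point of a stratum of a boundary to the generic point of the stratum and
back to a neighbouring point: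

* `mem_support_iff_stalkIdeal_le_primeOfSpecializes` — `ζ ∈ Supp(𝒪_X/I) ↔ I_x ≤ 𝔭_ζ` for
  `ζ ⤳ x` (`I_ζ = I_x 𝒪_{X,ζ}`, `stalkIdeal_map_stalkSpecializes`);
* `exists_nhds_forall_mem_support_iff_specializes` — **if the stalks at `v` of finitely or
  infinitely many ideal sheaves `I ∈ S` generate a PRIME `q`, then near `v` the intersection of
  their supports is the closure of the generisation `ζ = η_q` of `v`**: on some open `U ∋ v`,
  `(∀ I ∈ S, w ∈ Supp I) ↔ ζ ⤳ w` (locally Noetherian `X`);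
* `isLocalizationAtPrime_stalk_fromSpecStalk` — `𝒪_{X,η_q} = (𝒪_{X,v})_q`;
* `primeOfSpecializes_eq_of_map_eq` — **the prime of `ζ` at a second specialisation**: if
  `ζ ⤳ v`, `ζ ⤳ w` and a prime `Q ⊆ 𝒪_{X,w}` extends to the same ideal of `𝒪_{X,ζ}` as `𝔭_ζ^{(v)}`
  (e.g. both are the stalk of one ideal sheaf), then `𝔭_ζ^{(w)} = Q` (so `𝒪_{X,ζ} = (𝒪_{X,w})_Q`
  as well);
* `isUnit_stalkSpecializes_iff` — `f ∈ 𝒪_{X,x}` becomes a unit in `𝒪_{X,ζ}` iff `f ∉ 𝔭_ζ`.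

## Sources

* The Stacks Project, Tag 01J7 (points of `Spec 𝒪_{X,x}` are the generisations of `x`;
  `𝒪_{X,ζ}` is a localisation of `𝒪_{X,x}`). [StacksProject]
* A. Grothendieck, J. Dieudonné, *EGA* I (1960), Ch. I, 2.4. Folklore packaging; everything here
  is proved from the tree files cited above.
-/

noncomputable section

open CategoryTheory AlgebraicGeometry TopologicalSpace Topology IsLocalRing

universe u

namespace Literature.AlgebraicGeometry.Resolution

open Scheme.IdealSheafData

variable {X : Scheme.{u}}

/-! ## Units and supports along a specialisation -/

/-- Along `ζ ⤳ x`, a germ `f ∈ 𝒪_{X,x}` maps to a unit of `𝒪_{X,ζ}` iff `f ∉ 𝔭_ζ`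
(by definition of `𝔭_ζ = (𝒪_{X,x} → 𝒪_{X,ζ})⁻¹ 𝔪_ζ`). [cite: StacksProject, Tag 01J7] -/
theorem isUnit_stalkSpecializes_iff {ζ x : X} (h : ζ ⤳ x) (f : X.presheaf.stalk x) :
    IsUnit ((X.presheaf.stalkSpecializes h).hom f) ↔ f ∉ primeOfSpecializes h := by
  rw [primeOfSpecializes, Ideal.mem_comap, IsLocalRing.mem_maximalIdeal, mem_nonunits_iff, not_not]

-- adapted from `fromSpecStalk_mem_support_iff` (`AlterationsNormalFormBlowupFormal.lean`, proved
-- there from a chart; private copy to keep the imports of this file light)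
/-- **`η_q ∈ Supp(𝒪_X/I) ↔ I_v ≤ q`** for a point `q` of `Spec 𝒪_{X,v}` with image `η_q ∈ X`:
the stalk `I_{η_q}` is the extension of `I_v` along `𝒪_{X,v} → 𝒪_{X,η_q}`, whose preimage of the
maximal ideal is `q`. [cite: StacksProject, Tag 01J7] -/
private theorem fromSpecStalk_mem_support_iff' {v : X} (I : X.IdealSheafData)
    (q : PrimeSpectrum (X.presheaf.stalk v)) :
    X.fromSpecStalk v q ∈ I.support ↔ stalkIdeal I v ≤ q.asIdeal := by
  rw [mem_support_iff_stalkIdeal_le, ← stalkIdeal_map_stalkSpecializes I (fromSpecStalk_specializes q),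
    Ideal.map_le_iff_le_comap]
  change stalkIdeal I v ≤ primeOfSpecializes (fromSpecStalk_specializes q) ↔ _
  rw [primeOfSpecializes_fromSpecStalk]

/-- Along `ζ ⤳ x`: `ζ ∈ Supp(𝒪_X/I) ↔ I_x ≤ 𝔭_ζ`. [cite: StacksProject, Tag 01J7] -/
theorem mem_support_iff_stalkIdeal_le_primeOfSpecializes {ζ x : X} (h : ζ ⤳ x)
    (I : X.IdealSheafData) : ζ ∈ I.support ↔ stalkIdeal I x ≤ primeOfSpecializes h := by
  rw [mem_support_iff_stalkIdeal_le, ← stalkIdeal_map_stalkSpecializes I h,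
    Ideal.map_le_iff_le_comap]

/-! ## Near `v`, the common support of ideal sheaves whose stalks generate a prime -/

/-- **Near `v`, the intersection of the supports of ideal sheaves whose stalks at `v` generate a
prime `q` is the closure of the generisation `η_q`.** Let `X` be locally Noetherian, `v ∈ X`, `S` a
set of ideal sheaves and `q` a prime of `𝒪_{X,v}` with `⨆_{I ∈ S} I_v = q`. Then there is an open
`U ∋ v` such that for `w ∈ U`: `w ∈ Supp I` for all `I ∈ S` iff `η_q ⤳ w`. [folklore] -/
theorem exists_nhds_forall_mem_support_iff_specializes [IsLocallyNoetherian X] (v : X)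
    (S : Set X.IdealSheafData) (q : PrimeSpectrum (X.presheaf.stalk v))
    (hq : ⨆ I ∈ S, stalkIdeal I v = q.asIdeal) :
    ∃ U : X.Opens, v ∈ U ∧ ∀ w ∈ U, ((∀ I ∈ S, w ∈ I.support) ↔ X.fromSpecStalk v q ⤳ w) := by
  set Z : Set X := ⋂ I ∈ S, ((I.support : Closeds X) : Set X) with hZ
  have hZc : IsClosed Z := isClosed_biInter fun I _ => I.support.isClosed
  have htrace : ∀ q' : PrimeSpectrum (X.presheaf.stalk v),
      X.fromSpecStalk v q' ∈ Z ↔ q.asIdeal ≤ q'.asIdeal := by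
    intro q'
    simp only [hZ, Set.mem_iInter, SetLike.mem_coe, fromSpecStalk_mem_support_iff', ← hq,
      iSup₂_le_iff]
  obtain ⟨U, hvU, hU⟩ := exists_nhds_mem_iff_specializes_of_forall_fromSpecStalk hZc v q htrace
  refine ⟨U, hvU, fun w hw => ?_⟩
  rw [← hU w hw, hZ]
  simp only [Set.mem_iInter, SetLike.mem_coe]

/-- One ideal sheaf: if `I_v = q` is prime, then near `v`, `Supp I` is the closure of `η_q`.
[folklore] -/
theorem exists_nhds_mem_support_iff_specializes [IsLocallyNoetherian X] (v : X)
    (I : X.IdealSheafData) (q : PrimeSpectrum (X.presheaf.stalk v)) (hq : stalkIdeal I v = q.asIdeal) :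
    ∃ U : X.Opens, v ∈ U ∧ ∀ w ∈ U, (w ∈ I.support ↔ X.fromSpecStalk v q ⤳ w) := by
  obtain ⟨U, hvU, hU⟩ := exists_nhds_forall_mem_support_iff_specializes v {I} q (by simpa using hq)
  exact ⟨U, hvU, fun w hw => by simpa using hU w hw⟩

/-- Two ideal sheaves: if `I_v ⊔ J_v = q` is prime, then near `v`, `Supp I ∩ Supp J` is the
closure of `η_q`. [folklore] -/
theorem exists_nhds_mem_support_inter_iff_specializes [IsLocallyNoetherian X] (v : X)
    (I J : X.IdealSheafData) (q : PrimeSpectrum (X.presheaf.stalk v))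
    (hq : stalkIdeal I v ⊔ stalkIdeal J v = q.asIdeal) :
    ∃ U : X.Opens, v ∈ U ∧ ∀ w ∈ U, (w ∈ I.support ∧ w ∈ J.support ↔ X.fromSpecStalk v q ⤳ w) := by
  obtain ⟨U, hvU, hU⟩ := exists_nhds_forall_mem_support_iff_specializes v {I, J} q (by
    rw [← hq, iSup_insert, iSup_singleton])
  refine ⟨U, hvU, fun w hw => ?_⟩
  rw [← hU w hw]
  simp only [Set.mem_insert_iff, Set.mem_singleton_iff, forall_eq_or_imp, forall_eq]

/-! ## The local ring at a generisation as a localisation, from two points -/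

/-- `IsLocalization.AtPrime S P` only depends on the prime ideal `P`, not on the primality
witness. [folklore] -/
theorem isLocalizationAtPrime_congr {R S : Type*} [CommRing R] [CommRing S] [Algebra R S]
    {P Q : Ideal R} [P.IsPrime] [Q.IsPrime] (hPQ : P = Q)
    (h : IsLocalization.AtPrime S P) : IsLocalization.AtPrime S Q := by
  subst hPQ
  exact h

/-- **`𝒪_{X,η_q} = (𝒪_{X,v})_q`** for a point `q` of `Spec 𝒪_{X,v}` (Stacks 01J7, in the
`fromSpecStalk` parametrisation). [cite: StacksProject, Tag 01J7] -/
theorem isLocalizationAtPrime_stalk_fromSpecStalk {v : X} (q : PrimeSpectrum (X.presheaf.stalk v)) :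
    letI := (X.presheaf.stalkSpecializes (fromSpecStalk_specializes q)).hom.toAlgebra
    IsLocalization.AtPrime (X.presheaf.stalk (X.fromSpecStalk v q)) q.asIdeal := by
  letI := (X.presheaf.stalkSpecializes (fromSpecStalk_specializes q)).hom.toAlgebra
  have h := isLocalizationAtPrime_stalkSpecializes (fromSpecStalk_specializes q)
  have heq : (maximalIdeal (X.presheaf.stalk (X.fromSpecStalk v q))).comap
      (X.presheaf.stalkSpecializes (fromSpecStalk_specializes q)).hom = q.asIdeal :=
    primeOfSpecializes_fromSpecStalk q
  exact isLocalizationAtPrime_congr heq h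

/-- **The prime of a generisation at a second specialisation.** Let `ζ ⤳ v` and `ζ ⤳ w`, and let
`Q` be a prime of `𝒪_{X,w}` whose extension to `𝒪_{X,ζ}` equals the extension of `𝔭_ζ^{(v)}`
(which is `𝔪_ζ`, as `𝒪_{X,ζ} = (𝒪_{X,v})_{𝔭_ζ}`). Then `𝔭_ζ^{(w)} = Q`: indeed `Q ⊆ 𝔭_ζ^{(w)}`, and
in the localisation `𝒪_{X,ζ} = (𝒪_{X,w})_{𝔭_ζ}` the prime `Q` is contracted from its extension
`𝔪_ζ`. [cite: StacksProject, Tag 01J7] -/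
theorem primeOfSpecializes_eq_of_map_eq {v w ζ : X} (hv : ζ ⤳ v) (hw : ζ ⤳ w)
    (Q : Ideal (X.presheaf.stalk w)) [hQ : Q.IsPrime]
    (h : Q.map (X.presheaf.stalkSpecializes hw).hom =
      (primeOfSpecializes hv).map (X.presheaf.stalkSpecializes hv).hom) :
    primeOfSpecializes hw = Q := by
  -- from `v`: the extension of `𝔭_ζ^{(v)}` is `𝔪_ζ`
  have hmax : (primeOfSpecializes hv).map (X.presheaf.stalkSpecializes hv).hom =
      maximalIdeal (X.presheaf.stalk ζ) := by
    letI := (X.presheaf.stalkSpecializes hv).hom.toAlgebra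
    haveI : IsLocalization.AtPrime (X.presheaf.stalk ζ) (primeOfSpecializes hv) :=
      isLocalizationAtPrime_stalkSpecializes hv
    exact IsLocalization.AtPrime.map_eq_maximalIdeal (primeOfSpecializes hv) (X.presheaf.stalk ζ)
  rw [hmax] at h
  -- from `w`: `Q ⊆ 𝔭_ζ^{(w)}` and `Q` is contracted from its extension
  letI := (X.presheaf.stalkSpecializes hw).hom.toAlgebra
  haveI : IsLocalization.AtPrime (X.presheaf.stalk ζ) (primeOfSpecializes hw) :=
    isLocalizationAtPrime_stalkSpecializes hw
  have hle : Q ≤ primeOfSpecializes hw := by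
    rw [primeOfSpecializes, ← Ideal.map_le_iff_le_comap]
    exact h.le
  have hdisj : Disjoint ((primeOfSpecializes hw).primeCompl : Set (X.presheaf.stalk w)) Q := by
    rw [Set.disjoint_left]
    intro f hf hfQ
    exact hf (hle hfQ)
  have key := IsLocalization.under_map_of_isPrime_disjoint (primeOfSpecializes hw).primeCompl
    (X.presheaf.stalk ζ) hQ hdisj
  rw [Ideal.under_def] at key
  change (Q.map (X.presheaf.stalkSpecializes hw).hom).comap (X.presheaf.stalkSpecializes hw).hom = Q
    at key
  rw [h] at key
  exact key

/-- In the situation of `primeOfSpecializes_eq_of_map_eq`, `𝒪_{X,ζ}` is the localisation of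
`𝒪_{X,w}` at `Q`. [cite: StacksProject, Tag 01J7] -/
theorem isLocalizationAtPrime_of_map_eq {v w ζ : X} (hv : ζ ⤳ v) (hw : ζ ⤳ w)
    (Q : Ideal (X.presheaf.stalk w)) [Q.IsPrime]
    (h : Q.map (X.presheaf.stalkSpecializes hw).hom =
      (primeOfSpecializes hv).map (X.presheaf.stalkSpecializes hv).hom) :
    letI := (X.presheaf.stalkSpecializes hw).hom.toAlgebra
    IsLocalization.AtPrime (X.presheaf.stalk ζ) Q := by
  letI := (X.presheaf.stalkSpecializes hw).hom.toAlgebra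
  have h1 := isLocalizationAtPrime_stalkSpecializes hw
  have h2 : (maximalIdeal (X.presheaf.stalk ζ)).comap (X.presheaf.stalkSpecializes hw).hom = Q :=
    primeOfSpecializes_eq_of_map_eq hv hw Q h
  exact isLocalizationAtPrime_congr h2 h1

/-- **Two points of the support of an ideal sheaf under a common generisation see associated
generators at it**: for `ζ ⤳ x`, the stalk `I_ζ` is generated by the image of any generator of
`I_x`. [folklore] -/
theorem stalkIdeal_eq_span_stalkSpecializes {ζ x : X} (h : ζ ⤳ x) (I : X.IdealSheafData)
    {f : X.presheaf.stalk x} (hf : stalkIdeal I x = Ideal.span {f}) :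
    stalkIdeal I ζ = Ideal.span {(X.presheaf.stalkSpecializes h).hom f} := by
  rw [← stalkIdeal_map_stalkSpecializes I h, hf, Ideal.map_span, Set.image_singleton]

end Literature.AlgebraicGeometry.Resolution

end
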